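import Summits.BirchSwinnertonDyer.BirchSwinnertonDyer.Theses.PrintX10b
import Summits.BirchSwinnertonDyer.BirchSwinnertonDyer.Theorems.PrintX9MuPartStabilizedWeakLetters
import Summits.BirchSwinnertonDyer.BirchSwinnertonDyer.Theorems.PrintX10bHowardContainmentAnyClassNumberX10bThm413Hyp
import Summits.BirchSwinnertonDyer.Rank1Residual.X9.LeafDischargeScalarImage
import Literature.NumberTheory.EllipticCurves.CastellaGrossiLeeSkinner2022.HowardDivisibilityAnyClassNumber
import Literature.NumberTheory.EllipticCurves.HeegnerCharIdealEnvelopeProofs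
import Literature.NumberTheory.EllipticCurves.HeegnerCharIdealEnvelopePowTransferProofs
import Literature.NumberTheory.EllipticCurves.IwasawaAlgebraPromotionProofs
import Literature.NumberTheory.EllipticCurves.LambdaAdicSelmerDataProofs
import Literature.NumberTheory.EllipticCurves.IwasawaSelmerDualProofs
import Literature.NumberTheory.EllipticCurves.HeegnerGeomCoherentDataOfFrameProofs
import HarnessLib

/-!
# Skeleton v8 (lead bsd-line-x10b-p1 g4, 2026-08-28) for the crux `BeyondCarrierDepthX10b`
(stmt-BirchSwinnertonDyer-23055, PrintX10b aside r301) of `route-BirchSwinnertonDyer-PrintX10b` — line «twins»;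
v7 re-cut to plan g10's THE CUT v2 (2026-08-28T12:02Z): the cell's shared μ-item is the COHERENT-PAIR letter
`HeegnerMuPartStabilized.MuPartStabilizedCoherentPair` (L∃; tribunal-w g9's FINDING MU-LETTER-∀C upheld; file p630902;
route decl `MuInequalityCoherentPair` on both rows), so the ONE open stub of this line IS that letter BY SIGNATURE.

History. v3 (plan g5, 8c72ce4e) · v4 · v5 (lead g0, fc3088a6) · v6/v6.1/v6.2 (lead g2, 1c8a98c8: μ-split in the tied
currency) · v7 (lead g4: μ-split in the stabilised currency, open stub = the ∀C letter `MuPartStabilizedOfPrint`) · v8 (THIS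
file): the coherent pair `(C, F)` AND the μ-inequality at that `C` both come from the letter L∃, so v7's envelope stub s2a is
absorbed; the letter's tower input `K_k ⊆ K[p^{k+1}]` (classical CFT) becomes the explicit stub `stub_anticyclotomicTowerSharp`
(= the routes' support item `AnticyclotomicTowerSharp` BY SIGNATURE, cite-only), its `[K[p] : K[1]] = p − 1` input is the tree
theorem `card_ringClassGalOver_prime_one_of_frame`, `p ∤ N` is `ClassX10.not_dvd_conductorNorm`.
* s1 `stub_upperLink_coprimeClassNumber` — U₃ on the `3 ∤ h_K` frames (v5 verbatim; kernel witness p609477 mod MZ26 Cor. 4.6 + pinned facts).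
* s_tw `stub_anticyclotomicTowerSharp` — `K_k ⊆ K[p^{k+1}]` for K imaginary quadratic, p odd, κ anticyclotomic (Cox 7.24 /
  PR87 §3.2; cite-only support item 27076's letter VERBATIM).
* s2b `stub_localizedStabilizedTorsion_divisibleClassNumber` — CGLS Thm. 4.1.1 + 4.1.3 at `(D, C, X)` (v7 verbatim; witness p629662
  mod thm411/thm413).
* s2c `stub_muPartStabilizedCoherentPair : HeegnerMuPartStabilized.MuPartStabilizedCoherentPair` — THE open stub = the shared μ-item
  (beyond citable print at `p ∣ h_K`, REF-118; port of How04 Thm. 2.2.10 at `𝔮 = T^m + p` over the stabilised tower).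
* s2d `stub_upperLink_of_pinnedContainment`, s3 `stub_beyondCarrier_of_upperLink` — v6.2 verbatim (witnesses p614983 / p609388).
Composition `BeyondCarrierDepthX10b_of` (sorry-free): glue s3; `3 ∤ h_K` ↦ s1; `3 ∣ h_K` ↦ `jbar := IsAlgClosed.lift` along `ιC`;
`D`, `X` exist; s2c with the frame discharge (`X10.thm413Hypotheses_of_classX10`, `ClassX10.irr`,
`ClassX10.hasPadicScalarImage_of_not_surj`, `ClassX10.not_dvd_conductorNorm`, s_tw, `card_ringClassGalOver_prime_one_of_frame`) at
`(Dt, H.β, D, X)` ⇒ `(C, F)`, `ℋ_F ≤ Λκ_C`, `g • Λκ_C ≤ ℋ_F`, inequality at `C`; s2b at `(D, C, X)`; `𝔖/ℋ_F` torsion by transport;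
promotion (p613811) `I(Λκ_C)² ⊆ char`; `I(ℋ_F) ⊆ I(Λκ_C)`; s2d ⇒ U₃. By-name twin in the tree: p631498
`beyondCarrierDepthX10b_of_muPartStabilizedCoherentPair_of_namedFacts`.
CENSUS (numbers): 1 open statement (s2c = the shared μ-item); 1 cite-only classical stub (s_tw = support item); 4 stubs closed
modulo cite-only facts {h46; thm411, thm413; h57 h59gp h422 h513 hC h331; hChaL hKo}. Disproof used: none exists (`ledger crux ls`).
BSD is not proved by any of this; no summit statement is proved by this seat.
-/

set_option linter.dupNamespace false
set_option autoImplicit false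

noncomputable section

open scoped Classical Pointwise

namespace Summit.BirchSwinnertonDyer.BirchSwinnertonDyer.Cruxes.BeyondCarrierDepthX10b.HowardFrames

open Summit.BirchSwinnertonDyer.BirchSwinnertonDyer.Theses.PrintX10b
open Summit.BirchSwinnertonDyer.BirchSwinnertonDyer.Theorems.HeegnerMuPartStabilized (MuPartStabilizedCoherentPair)
open Literature.NumberTheory.EllipticCurves

/-! ## §1 Statements (abbreviations used ONLY in the composition's binders; every stub below spells its
signature out in full so that the registered text is self-contained) -/

/-- The frame-wise one-sided link U₃ on the `3 ∤ h_K` frames (v5 stub₁ text). -/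
def Stmt.upperLinkCoprime : Prop :=
  ∀ (W : WeierstrassCurve ℚ) [W.IsElliptic] [W.IsGloballyMinimal] (p : ℕ) [Fact p.Prime]
    [NeZero (W.conductorNorm ℤ)] (K : Type) [Field K] [NumberField K],
    Literature.NumberTheory.EllipticCurves.Rank1Residual.ClassX10 W p →
    ¬ Literature.NumberTheory.EllipticCurves.Rank1Residual.Surj W 3 → ¬ W.HasCM →
    Literature.NumberTheory.EllipticCurves.IsImaginaryQuadratic K → Odd (NumberField.discr K) →
    NumberField.discr K ≠ -3 →
    Literature.NumberTheory.EllipticCurves.SatisfiesHeegnerHypothesis (W.conductorNorm ℤ) K →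
    Literature.NumberTheory.EllipticCurves.SatisfiesHeegnerHypothesis p K →
    ¬ p ∣ NumberField.classNumber K →
    (W.baseChange K).HasIrreducibleModPGaloisRep p →
    ∀ (ι : K →+* ℚ_[p]) (κ : Literature.NumberTheory.EllipticCurves.ZpExtension K p), κ.IsAnticyclotomic →
    ∀ (γ : Field.absoluteGaloisGroup K) [Fact (κ.IsTopGenerator γ)]
    (Dt : Literature.NumberTheory.EllipticCurves.ModularForms.ModularParametrizationData W
    (W.conductorNorm ℤ)), ¬ (p : ℤ) ∣ Dt.c →
    ∀ (H : Literature.NumberTheory.EllipticCurves.HeegnerDatum (W.conductorNorm ℤ) (NumberField.discr K))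
    (ιC : K →+* ℂ) (P : (W.baseChange K).toAffine.Point),
    WeierstrassCurve.Affine.Point.map ιC.toRatAlgHom P =
    Literature.NumberTheory.EllipticCurves.ModularForms.heegnerPointComplex Dt H →
    (W.baseChange K).mordellWeilRank = 1 →
    Finite (AddCommGroup.primaryComponent (W.baseChange K).sha p) → ¬ IsOfFinAddOrder P →
    ∃ n : ℕ, Summit.BirchSwinnertonDyer.Rank1Residual.X11b.AcSelmer.XAc.HasCharValuationAt
    (W.baseChange K) p κ (Summit.BirchSwinnertonDyer.Rank1Residual.X11b.inducedPlace ι) ∅ γ n ∧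
    (n : ℤ) ≤ 2 * (Summit.BirchSwinnertonDyer.Rank1Residual.X11b.padicLogOrd W p ι P +
    (padicValInt p (1 - W.frobeniusTrace p + p) : ℤ) - 1)


/-- s_tw text (v8): the anticyclotomic tower clause `K_k ⊆ K[p^{k+1}]` (letter of the routes' support item
`AnticyclotomicTowerSharp`). -/
def Stmt.towerSharp : Prop :=
    ∀ (K : Type) [Field K] [NumberField K] (p : ℕ) [Fact p.Prime], Odd p →
    Literature.NumberTheory.EllipticCurves.IsImaginaryQuadratic K →
    ∀ (κ : Literature.NumberTheory.EllipticCurves.ZpExtension K p), κ.IsAnticyclotomic →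
    ∀ (jbar : AlgebraicClosure K →+* ℂ) (k : ℕ),
    Literature.NumberTheory.EllipticCurves.ringClassSubgroup K (p ^ (k + 1)) jbar ≤ κ.layerSubgroup k

/-- s2b text (v7): CGLS Thm. 4.1.1 (torsion of `𝔖/Λκ_∞(C)`) + Thm. 4.1.3 localized, `∀`-form at `(D, C, X)`, on
the rank-one `3 ∣ h_K` X10b frames. -/
def Stmt.localizedStabilizedTorsion : Prop :=
    ∀ (W : WeierstrassCurve ℚ) [W.IsElliptic] [W.IsGloballyMinimal] (p : ℕ) [Fact p.Prime]
    [NeZero (W.conductorNorm ℤ)] (K : Type) [Field K] [NumberField K],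
    Literature.NumberTheory.EllipticCurves.Rank1Residual.ClassX10 W p →
    ¬ Literature.NumberTheory.EllipticCurves.Rank1Residual.Surj W 3 → ¬ W.HasCM →
    Literature.NumberTheory.EllipticCurves.IsImaginaryQuadratic K → Odd (NumberField.discr K) →
    NumberField.discr K ≠ -3 →
    Literature.NumberTheory.EllipticCurves.SatisfiesHeegnerHypothesis (W.conductorNorm ℤ) K →
    Literature.NumberTheory.EllipticCurves.SatisfiesHeegnerHypothesis p K →
    p ∣ NumberField.classNumber K →
    (W.baseChange K).HasIrreducibleModPGaloisRep p →
    ∀ (κ : Literature.NumberTheory.EllipticCurves.ZpExtension K p), κ.IsAnticyclotomic →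
    ∀ (γ : Field.absoluteGaloisGroup K), κ.IsTopGenerator γ →
    ∀ (jbar : AlgebraicClosure K →+* ℂ),
    (W.baseChange K).mordellWeilRank = 1 →
    Finite (AddCommGroup.primaryComponent (W.baseChange K).sha p) →
    ∀ (D : (W.baseChange K).LambdaAdicSelmerData κ γ)
      (C : Literature.NumberTheory.EllipticCurves.CastellaGrossiLeeSkinner2022.StabilizedHeegnerData
        (W.conductorNorm ℤ) W K κ jbar)
      (X : (W.baseChange K).SelmerDualData κ γ),
    Module.Finite (Literature.NumberTheory.EllipticCurves.IwasawaAlgebra p) D.S ∧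
    Module.Finite (Literature.NumberTheory.EllipticCurves.IwasawaAlgebra p) X.X ∧
    Module.IsTorsion (Literature.NumberTheory.EllipticCurves.IwasawaAlgebra p)
      (D.S ⧸ Literature.NumberTheory.EllipticCurves.CastellaGrossiLeeSkinner2022.stabilizedHeegnerModule D C) ∧
    ∃ m : ℕ, Ideal.span {((p : Literature.NumberTheory.EllipticCurves.IwasawaAlgebra p) ^ m)} *
          Literature.NumberTheory.EllipticCurves.CastellaGrossiLeeSkinner2022.stabilizedHeegnerCharIdeal D C ^ 2 ≤
        Literature.NumberTheory.EllipticCurves.Module.charIdeal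
          (Literature.NumberTheory.EllipticCurves.IwasawaAlgebra p)
          (Submodule.torsion (Literature.NumberTheory.EllipticCurves.IwasawaAlgebra p) X.X)

/-- s2d text: the PINNED containment on a U₃ frame (any class number) gives U₃ there. -/
def Stmt.upperLinkOfPinnedContainment : Prop :=
  ∀ (W : WeierstrassCurve ℚ) [W.IsElliptic] [W.IsGloballyMinimal] (p : ℕ) [Fact p.Prime]
    [NeZero (W.conductorNorm ℤ)] (K : Type) [Field K] [NumberField K],
    Literature.NumberTheory.EllipticCurves.Rank1Residual.ClassX10 W p →
    ¬ Literature.NumberTheory.EllipticCurves.Rank1Residual.Surj W 3 → ¬ W.HasCM →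
    Literature.NumberTheory.EllipticCurves.IsImaginaryQuadratic K → Odd (NumberField.discr K) →
    NumberField.discr K ≠ -3 →
    Literature.NumberTheory.EllipticCurves.SatisfiesHeegnerHypothesis (W.conductorNorm ℤ) K →
    Literature.NumberTheory.EllipticCurves.SatisfiesHeegnerHypothesis p K →
    (W.baseChange K).HasIrreducibleModPGaloisRep p →
    ∀ (ι : K →+* ℚ_[p]) (κ : Literature.NumberTheory.EllipticCurves.ZpExtension K p), κ.IsAnticyclotomic →
    ∀ (γ : Field.absoluteGaloisGroup K) [Fact (κ.IsTopGenerator γ)]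
    (Dt : Literature.NumberTheory.EllipticCurves.ModularForms.ModularParametrizationData W
    (W.conductorNorm ℤ)), ¬ (p : ℤ) ∣ Dt.c →
    ∀ (H : Literature.NumberTheory.EllipticCurves.HeegnerDatum (W.conductorNorm ℤ) (NumberField.discr K))
    (ιC : K →+* ℂ) (P : (W.baseChange K).toAffine.Point),
    WeierstrassCurve.Affine.Point.map ιC.toRatAlgHom P =
    Literature.NumberTheory.EllipticCurves.ModularForms.heegnerPointComplex Dt H →
    (W.baseChange K).mordellWeilRank = 1 →
    Finite (AddCommGroup.primaryComponent (W.baseChange K).sha p) → ¬ IsOfFinAddOrder P →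
    (∃ (jbar : AlgebraicClosure K →+* ℂ) (D : (W.baseChange K).LambdaAdicSelmerData κ γ)
        (F : Literature.NumberTheory.EllipticCurves.HeegnerFamily (W.conductorNorm ℤ) W K κ jbar)
        (X : (W.baseChange K).SelmerDualData κ γ),
        F.Dt = Dt ∧ Literature.NumberTheory.EllipticCurves.heegnerCharIdeal D F ^ 2 ≤
          Literature.NumberTheory.EllipticCurves.Module.charIdeal
            (Literature.NumberTheory.EllipticCurves.IwasawaAlgebra p)
            (Submodule.torsion (Literature.NumberTheory.EllipticCurves.IwasawaAlgebra p) X.X)) →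
    ∃ n : ℕ, Summit.BirchSwinnertonDyer.Rank1Residual.X11b.AcSelmer.XAc.HasCharValuationAt
    (W.baseChange K) p κ (Summit.BirchSwinnertonDyer.Rank1Residual.X11b.inducedPlace ι) ∅ γ n ∧
    (n : ℤ) ≤ 2 * (Summit.BirchSwinnertonDyer.Rank1Residual.X11b.padicLogOrd W p ι P +
    (padicValInt p (1 - W.frobeniusTrace p + p) : ℤ) - 1)

/-- The frame-wise one-sided link U₃ on ALL odd-`d_K` X10b frames (the hypothesis of v5 stub₃). -/
def Stmt.upperLinkAll : Prop :=
  ∀ (W : WeierstrassCurve ℚ) [W.IsElliptic] [W.IsGloballyMinimal] (p : ℕ) [Fact p.Prime]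
    [NeZero (W.conductorNorm ℤ)] (K : Type) [Field K] [NumberField K],
    Literature.NumberTheory.EllipticCurves.Rank1Residual.ClassX10 W p →
    ¬ Literature.NumberTheory.EllipticCurves.Rank1Residual.Surj W 3 → ¬ W.HasCM →
    Literature.NumberTheory.EllipticCurves.IsImaginaryQuadratic K → Odd (NumberField.discr K) →
    NumberField.discr K ≠ -3 →
    Literature.NumberTheory.EllipticCurves.SatisfiesHeegnerHypothesis (W.conductorNorm ℤ) K →
    Literature.NumberTheory.EllipticCurves.SatisfiesHeegnerHypothesis p K →
    (W.baseChange K).HasIrreducibleModPGaloisRep p →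
    ∀ (ι : K →+* ℚ_[p]) (κ : Literature.NumberTheory.EllipticCurves.ZpExtension K p), κ.IsAnticyclotomic →
    ∀ (γ : Field.absoluteGaloisGroup K) [Fact (κ.IsTopGenerator γ)]
    (Dt : Literature.NumberTheory.EllipticCurves.ModularForms.ModularParametrizationData W
    (W.conductorNorm ℤ)), ¬ (p : ℤ) ∣ Dt.c →
    ∀ (H : Literature.NumberTheory.EllipticCurves.HeegnerDatum (W.conductorNorm ℤ) (NumberField.discr K))
    (ιC : K →+* ℂ) (P : (W.baseChange K).toAffine.Point),
    WeierstrassCurve.Affine.Point.map ιC.toRatAlgHom P =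
    Literature.NumberTheory.EllipticCurves.ModularForms.heegnerPointComplex Dt H →
    (W.baseChange K).mordellWeilRank = 1 →
    Finite (AddCommGroup.primaryComponent (W.baseChange K).sha p) → ¬ IsOfFinAddOrder P →
    ∃ n : ℕ, Summit.BirchSwinnertonDyer.Rank1Residual.X11b.AcSelmer.XAc.HasCharValuationAt
    (W.baseChange K) p κ (Summit.BirchSwinnertonDyer.Rank1Residual.X11b.inducedPlace ι) ∅ γ n ∧
    (n : ℤ) ≤ 2 * (Summit.BirchSwinnertonDyer.Rank1Residual.X11b.padicLogOrd W p ι P +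
    (padicValInt p (1 - W.frobeniusTrace p + p) : ℤ) - 1)


/-! ## §2 Registered stubs (signatures spelled out in full) -/

/-- stub s1 (= v5 stub₁): the one-sided link U₃ on the X10b Heegner frames with `3 ∤ h_K` — PRINT modulo
cite-only facts (kernel witness `…UpperHalf.upperLinkX10b_coprimeClassNumber_of_pinnedPrintFacts`, p609477:
MZ26 Cor. 4.6 tied + the pinned class-number-free transfer). -/
theorem stub_upperLink_coprimeClassNumber :
    ∀ (W : WeierstrassCurve ℚ) [W.IsElliptic] [W.IsGloballyMinimal] (p : ℕ) [Fact p.Prime]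
    [NeZero (W.conductorNorm ℤ)] (K : Type) [Field K] [NumberField K],
    Literature.NumberTheory.EllipticCurves.Rank1Residual.ClassX10 W p →
    ¬ Literature.NumberTheory.EllipticCurves.Rank1Residual.Surj W 3 → ¬ W.HasCM →
    Literature.NumberTheory.EllipticCurves.IsImaginaryQuadratic K → Odd (NumberField.discr K) →
    NumberField.discr K ≠ -3 →
    Literature.NumberTheory.EllipticCurves.SatisfiesHeegnerHypothesis (W.conductorNorm ℤ) K →
    Literature.NumberTheory.EllipticCurves.SatisfiesHeegnerHypothesis p K →
    ¬ p ∣ NumberField.classNumber K →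
    (W.baseChange K).HasIrreducibleModPGaloisRep p →
    ∀ (ι : K →+* ℚ_[p]) (κ : Literature.NumberTheory.EllipticCurves.ZpExtension K p), κ.IsAnticyclotomic →
    ∀ (γ : Field.absoluteGaloisGroup K) [Fact (κ.IsTopGenerator γ)]
    (Dt : Literature.NumberTheory.EllipticCurves.ModularForms.ModularParametrizationData W
    (W.conductorNorm ℤ)), ¬ (p : ℤ) ∣ Dt.c →
    ∀ (H : Literature.NumberTheory.EllipticCurves.HeegnerDatum (W.conductorNorm ℤ) (NumberField.discr K))
    (ιC : K →+* ℂ) (P : (W.baseChange K).toAffine.Point),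
    WeierstrassCurve.Affine.Point.map ιC.toRatAlgHom P =
    Literature.NumberTheory.EllipticCurves.ModularForms.heegnerPointComplex Dt H →
    (W.baseChange K).mordellWeilRank = 1 →
    Finite (AddCommGroup.primaryComponent (W.baseChange K).sha p) → ¬ IsOfFinAddOrder P →
    ∃ n : ℕ, Summit.BirchSwinnertonDyer.Rank1Residual.X11b.AcSelmer.XAc.HasCharValuationAt
    (W.baseChange K) p κ (Summit.BirchSwinnertonDyer.Rank1Residual.X11b.inducedPlace ι) ∅ γ n ∧
    (n : ℤ) ≤ 2 * (Summit.BirchSwinnertonDyer.Rank1Residual.X11b.padicLogOrd W p ι P +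
    (padicValInt p (1 - W.frobeniusTrace p + p) : ℤ) - 1) := by
  sorry


/-- stub s_tw (v8; CITE-ONLY classical CFT/CM — the routes' support item `AnticyclotomicTowerSharp` VERBATIM, so that this
stub is that item BY SIGNATURE): for K imaginary quadratic, p odd, κ the anticyclotomic ℤ_p-extension, the k-th layer `K_k` lies
in the ring class field `K[p^{k+1}]` at EVERY class number (`Gal(K̄/K[p^{k+1}]) ≤ Gal(K̄/K_k)`; any h_K: `Gal(K̄/K[p^{k+1}])` maps
into `p^k Γ` because the pro-p part of `Gal(K[p^∞]/K[1])` is `(1 + pℤ_p)`-shaped). Not provable in the tree today (Artin map /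
main theorem of CM absent). [cite: Cox2013Primes, Thm. 7.24] [cite: PerrinRiou1987BSMF, §3.2] [cite: CastellaGrossiLeeSkinner2022, §4.1 (d(k))] -/
theorem stub_anticyclotomicTowerSharp :
    ∀ (K : Type) [Field K] [NumberField K] (p : ℕ) [Fact p.Prime], Odd p →
    Literature.NumberTheory.EllipticCurves.IsImaginaryQuadratic K →
    ∀ (κ : Literature.NumberTheory.EllipticCurves.ZpExtension K p), κ.IsAnticyclotomic →
    ∀ (jbar : AlgebraicClosure K →+* ℂ) (k : ℕ),
    Literature.NumberTheory.EllipticCurves.ringClassSubgroup K (p ^ (k + 1)) jbar ≤ κ.layerSubgroup k := by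
  sorry

/-- stub s2b (v7; PRINT modulo the cite-only facts thm411/thm413; kernel witness
`stub_localizedStabilizedTorsion_divisibleClassNumber_of_cgls`): on a rank-one `3 ∣ h_K` X10b frame, at every
`(D, C, X)`: `𝔖`, `𝒳` finitely generated, `𝔖/Λκ_∞(C)` torsion (CGLS Thm. 4.1.1), and
`(p^m)·I(Λκ_∞(C))² ⊆ char_Λ(𝒳_tors)` (CGLS Thm. 4.1.3 localized).
[cite: CastellaGrossiLeeSkinner2022, Thm. 4.1.1, Thm. 4.1.3, Cor. 3.4.2 and Rem. 4.1.4] -/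
theorem stub_localizedStabilizedTorsion_divisibleClassNumber :
    ∀ (W : WeierstrassCurve ℚ) [W.IsElliptic] [W.IsGloballyMinimal] (p : ℕ) [Fact p.Prime]
    [NeZero (W.conductorNorm ℤ)] (K : Type) [Field K] [NumberField K],
    Literature.NumberTheory.EllipticCurves.Rank1Residual.ClassX10 W p →
    ¬ Literature.NumberTheory.EllipticCurves.Rank1Residual.Surj W 3 → ¬ W.HasCM →
    Literature.NumberTheory.EllipticCurves.IsImaginaryQuadratic K → Odd (NumberField.discr K) →
    NumberField.discr K ≠ -3 →
    Literature.NumberTheory.EllipticCurves.SatisfiesHeegnerHypothesis (W.conductorNorm ℤ) K →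
    Literature.NumberTheory.EllipticCurves.SatisfiesHeegnerHypothesis p K →
    p ∣ NumberField.classNumber K →
    (W.baseChange K).HasIrreducibleModPGaloisRep p →
    ∀ (κ : Literature.NumberTheory.EllipticCurves.ZpExtension K p), κ.IsAnticyclotomic →
    ∀ (γ : Field.absoluteGaloisGroup K), κ.IsTopGenerator γ →
    ∀ (jbar : AlgebraicClosure K →+* ℂ),
    (W.baseChange K).mordellWeilRank = 1 →
    Finite (AddCommGroup.primaryComponent (W.baseChange K).sha p) →
    ∀ (D : (W.baseChange K).LambdaAdicSelmerData κ γ)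
      (C : Literature.NumberTheory.EllipticCurves.CastellaGrossiLeeSkinner2022.StabilizedHeegnerData
        (W.conductorNorm ℤ) W K κ jbar)
      (X : (W.baseChange K).SelmerDualData κ γ),
    Module.Finite (Literature.NumberTheory.EllipticCurves.IwasawaAlgebra p) D.S ∧
    Module.Finite (Literature.NumberTheory.EllipticCurves.IwasawaAlgebra p) X.X ∧
    Module.IsTorsion (Literature.NumberTheory.EllipticCurves.IwasawaAlgebra p)
      (D.S ⧸ Literature.NumberTheory.EllipticCurves.CastellaGrossiLeeSkinner2022.stabilizedHeegnerModule D C) ∧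
    ∃ m : ℕ, Ideal.span {((p : Literature.NumberTheory.EllipticCurves.IwasawaAlgebra p) ^ m)} *
          Literature.NumberTheory.EllipticCurves.CastellaGrossiLeeSkinner2022.stabilizedHeegnerCharIdeal D C ^ 2 ≤
        Literature.NumberTheory.EllipticCurves.Module.charIdeal
          (Literature.NumberTheory.EllipticCurves.IwasawaAlgebra p)
          (Submodule.torsion (Literature.NumberTheory.EllipticCurves.IwasawaAlgebra p) X.X) := by
  sorry

/-- stub s2c (v8; OPEN, HARDEST, BEYOND CITABLE PRINT — the ONE research statement of the crux = the cell's shared μ-item of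
rows 9/10, plan g10 THE CUT v2): the coherent-pair μ-letter `HeegnerMuPartStabilized.MuPartStabilizedCoherentPair` VERBATIM — under
the printed hypotheses of CGLS Thm. 4.1.3 + MZ26 Cor. 4.6, `p ∣ h_K`, `p ∤ N` and the tower inputs, for every `(Dt, β, D, X)` THERE ARE
a stabilised datum `C` and a Howard family `F` on `(Dt, β)` with `ℋ_∞(F) ≤ Λκ_∞(C)`, `g • Λκ_∞(C) ≤ ℋ_∞(F)` (`g ≠ 0`) and
`length_(p)(𝒳_tors) ≤ 2 · length_(p)(𝔖/Λκ_∞(C))` AT THAT `C`. Kernel reductions: ⟸ the `∀ C` letter `MuPartStabilizedOfPrint`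
(`muPartStabilizedCoherentPair_of_print`) ⟸ Howard's specialised Kolyvagin index inequality at `q_m = T^m + p`, uniform in `m`
(p626469). [cite: Howard2004HeegnerKolyvagin, Thm. 2.2.10 (proof: 𝔮 = T^m + p)] [cite: MastellaZerman2026, Ass. 2.1 (iii), Thm. 2.40, Cor. 4.6]
[cite: CastellaGrossiLeeSkinner2022, Thm. 4.1.3, Rem. 4.1.4] -/
theorem stub_muPartStabilizedCoherentPair : MuPartStabilizedCoherentPair := by
  sorry

/-- stub s2d (PRINT modulo the pinned class-number-free facts; kernel witness `…_of_pinnedPrintFacts` this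
session): the PINNED containment `∃ jbar D F X, F.Dt = Dt ∧ I(ℋ_F)² ⊆ char_Λ(X_tors)` on a U₃ frame gives U₃
there (x10b-p3's two-sided link p608225, then its `≤` half). [cite: YanZhu2024MainConjNonCM, Thm. 5.7 (1), 5.9]
[cite: BurungaleCastellaSkinner2025, Prop. 4.2.2] [cite: CastellaGrossiLeeSkinner2022, Thm. 5.1.3]
[cite: JetchevSkinnerWan2017, Thm. 3.3.1] [cite: Castella2018, §5 (eq:IMC+BDP)] -/
theorem stub_upperLink_of_pinnedContainment :
    ∀ (W : WeierstrassCurve ℚ) [W.IsElliptic] [W.IsGloballyMinimal] (p : ℕ) [Fact p.Prime]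
    [NeZero (W.conductorNorm ℤ)] (K : Type) [Field K] [NumberField K],
    Literature.NumberTheory.EllipticCurves.Rank1Residual.ClassX10 W p →
    ¬ Literature.NumberTheory.EllipticCurves.Rank1Residual.Surj W 3 → ¬ W.HasCM →
    Literature.NumberTheory.EllipticCurves.IsImaginaryQuadratic K → Odd (NumberField.discr K) →
    NumberField.discr K ≠ -3 →
    Literature.NumberTheory.EllipticCurves.SatisfiesHeegnerHypothesis (W.conductorNorm ℤ) K →
    Literature.NumberTheory.EllipticCurves.SatisfiesHeegnerHypothesis p K →
    (W.baseChange K).HasIrreducibleModPGaloisRep p →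
    ∀ (ι : K →+* ℚ_[p]) (κ : Literature.NumberTheory.EllipticCurves.ZpExtension K p), κ.IsAnticyclotomic →
    ∀ (γ : Field.absoluteGaloisGroup K) [Fact (κ.IsTopGenerator γ)]
    (Dt : Literature.NumberTheory.EllipticCurves.ModularForms.ModularParametrizationData W
    (W.conductorNorm ℤ)), ¬ (p : ℤ) ∣ Dt.c →
    ∀ (H : Literature.NumberTheory.EllipticCurves.HeegnerDatum (W.conductorNorm ℤ) (NumberField.discr K))
    (ιC : K →+* ℂ) (P : (W.baseChange K).toAffine.Point),
    WeierstrassCurve.Affine.Point.map ιC.toRatAlgHom P =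
    Literature.NumberTheory.EllipticCurves.ModularForms.heegnerPointComplex Dt H →
    (W.baseChange K).mordellWeilRank = 1 →
    Finite (AddCommGroup.primaryComponent (W.baseChange K).sha p) → ¬ IsOfFinAddOrder P →
    (∃ (jbar : AlgebraicClosure K →+* ℂ) (D : (W.baseChange K).LambdaAdicSelmerData κ γ)
        (F : Literature.NumberTheory.EllipticCurves.HeegnerFamily (W.conductorNorm ℤ) W K κ jbar)
        (X : (W.baseChange K).SelmerDualData κ γ),
        F.Dt = Dt ∧ Literature.NumberTheory.EllipticCurves.heegnerCharIdeal D F ^ 2 ≤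
          Literature.NumberTheory.EllipticCurves.Module.charIdeal
            (Literature.NumberTheory.EllipticCurves.IwasawaAlgebra p)
            (Submodule.torsion (Literature.NumberTheory.EllipticCurves.IwasawaAlgebra p) X.X)) →
    ∃ n : ℕ, Summit.BirchSwinnertonDyer.Rank1Residual.X11b.AcSelmer.XAc.HasCharValuationAt
    (W.baseChange K) p κ (Summit.BirchSwinnertonDyer.Rank1Residual.X11b.inducedPlace ι) ∅ γ n ∧
    (n : ℤ) ≤ 2 * (Summit.BirchSwinnertonDyer.Rank1Residual.X11b.padicLogOrd W p ι P +
    (padicValInt p (1 - W.frobeniusTrace p + p) : ℤ) - 1) := by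
  sorry

/-- stub s3 (= v5 stub₃; kernel glue, PROVED modulo the cite-only facts h331 / hChaL / hKo by
`…UpperHalf.beyondCarrierDepthX10b_of_namedFacts_of_upperLink`, x10b-p1-w2 p607624): U₃ on all odd-`d_K` X10b
frames gives the body of the crux VERBATIM. -/
theorem stub_beyondCarrier_of_upperLink :
    (∀ (W : WeierstrassCurve ℚ) [W.IsElliptic] [W.IsGloballyMinimal] (p : ℕ) [Fact p.Prime]
    [NeZero (W.conductorNorm ℤ)] (K : Type) [Field K] [NumberField K],
    Literature.NumberTheory.EllipticCurves.Rank1Residual.ClassX10 W p →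
    ¬ Literature.NumberTheory.EllipticCurves.Rank1Residual.Surj W 3 → ¬ W.HasCM →
    Literature.NumberTheory.EllipticCurves.IsImaginaryQuadratic K → Odd (NumberField.discr K) →
    NumberField.discr K ≠ -3 →
    Literature.NumberTheory.EllipticCurves.SatisfiesHeegnerHypothesis (W.conductorNorm ℤ) K →
    Literature.NumberTheory.EllipticCurves.SatisfiesHeegnerHypothesis p K →
    (W.baseChange K).HasIrreducibleModPGaloisRep p →
    ∀ (ι : K →+* ℚ_[p]) (κ : Literature.NumberTheory.EllipticCurves.ZpExtension K p), κ.IsAnticyclotomic →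
    ∀ (γ : Field.absoluteGaloisGroup K) [Fact (κ.IsTopGenerator γ)]
    (Dt : Literature.NumberTheory.EllipticCurves.ModularForms.ModularParametrizationData W
    (W.conductorNorm ℤ)), ¬ (p : ℤ) ∣ Dt.c →
    ∀ (H : Literature.NumberTheory.EllipticCurves.HeegnerDatum (W.conductorNorm ℤ) (NumberField.discr K))
    (ιC : K →+* ℂ) (P : (W.baseChange K).toAffine.Point),
    WeierstrassCurve.Affine.Point.map ιC.toRatAlgHom P =
    Literature.NumberTheory.EllipticCurves.ModularForms.heegnerPointComplex Dt H →
    (W.baseChange K).mordellWeilRank = 1 →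
    Finite (AddCommGroup.primaryComponent (W.baseChange K).sha p) → ¬ IsOfFinAddOrder P →
    ∃ n : ℕ, Summit.BirchSwinnertonDyer.Rank1Residual.X11b.AcSelmer.XAc.HasCharValuationAt
    (W.baseChange K) p κ (Summit.BirchSwinnertonDyer.Rank1Residual.X11b.inducedPlace ι) ∅ γ n ∧
    (n : ℤ) ≤ 2 * (Summit.BirchSwinnertonDyer.Rank1Residual.X11b.padicLogOrd W p ι P +
    (padicValInt p (1 - W.frobeniusTrace p + p) : ℤ) - 1)) →
    ∀ (W : WeierstrassCurve ℚ) [W.IsElliptic] [W.IsGloballyMinimal] [NeZero (W.conductorNorm ℤ)] (p : ℕ) [Fact p.Prime], Literature.NumberTheory.EllipticCurves.Rank1Residual.ClassX10 W p → ¬ Literature.NumberTheory.EllipticCurves.Rank1Residual.Surj W 3 → ¬ W.HasCM → W.analyticRank = 1 → ∃ B : ℕ, ∀ (K : Type) [Field K] [NumberField K] (Dt : Literature.NumberTheory.EllipticCurves.ModularForms.ModularParametrizationData W (W.conductorNorm ℤ)) (β : ℤ) (ι : K →+* ℂ), Literature.NumberTheory.EllipticCurves.IsImaginaryQuadratic K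 → B < (NumberField.discr K).natAbs → NumberField.discr K % 8 = 1 → Literature.NumberTheory.EllipticCurves.SatisfiesHeegnerHypothesis (W.conductorNorm ℤ) K → Literature.NumberTheory.EllipticCurves.SatisfiesHeegnerHypothesis p K → (4 * (W.conductorNorm ℤ : ℤ)) ∣ β ^ 2 - NumberField.discr K → ¬ (p : ℤ) ∣ Dt.c → ∀ (d₁ : Literature.NumberTheory.EllipticCurves.KolyvaginHeegnerData Dt β ι 1), ¬ IsOfFinAddOrder d₁.derivedPoint → ∀ (s : ℕ), (∀ (q : ℕ) [Fact q.Prime], q ∣ W.conductorNorm ℤ → padicValNat p ((W.baseChange ℚ_[q]).localTamagawaNumber ℤ_[q]) < s) → s ≤ padicValNat p W.tamagawaProduct → ∀ (n : ℕ) (d : Literature.NumberTheory.EllipticCurves.KolyvaginHeegnerData Dt β ι n), Squarefree n → (∀ ℓ ∈ n.primeFactors, Literature.NumberTheory.EllipticCurves.Zhang2014.IsKolyvaginPrime (W.conductorNorm ℤ) W K p ℓ ∧ s ≤ Literature.NumberTheory.EllipticCurves.Zhang2014.kolyvaginIndex W p ℓ) → ∃ Q : (W.baseChange (Literature.NumberTheory.EllipticCurves.ringClassField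 K ι n)).toAffine.Point, ((p ^ s : ℕ) : ℤ) • Q = d.derivedPoint := by
  sorry


/-! ## §3 Composition (sorry-free) -/

/-- Local alias of the crux constant (so that exactly ONE theorem, `BeyondCarrierDepthX10b_of_stubs`,
concludes the crux by name). -/
def CruxGoal : Prop := BeyondCarrierDepthX10b


/-- **U₃ on the `3 ∣ h_K` frames, stabilised currency, coherent-pair letter** (letter at `(Dt, H.β, D, X)` with the frame
discharge and the tower stub ⇒ `(C, F)` + envelope + inequality at `C`; CGLS at `(D, C, X)`; promotion `I(Λκ_C)² ⊆ char`;
`I(ℋ_F) ⊆ I(Λκ_C)`; pinned containment for the tied `F`; transfer ⇒ U₃); sorry-free in the stubs.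
[cite: CastellaGrossiLeeSkinner2022, Thm. 4.1.1, Thm. 4.1.3, Rem. 4.1.4] [cite: Washington1997, §13.2]
[cite: LombardoTronto2022, Prop. 3.12] -/
theorem upperLinkDivisible_of
    (hTw : Stmt.towerSharp) (h₂b : Stmt.localizedStabilizedTorsion) (h₂c : MuPartStabilizedCoherentPair)
    (h₂d : Stmt.upperLinkOfPinnedContainment) :
    ∀ (W : WeierstrassCurve ℚ) [W.IsElliptic] [W.IsGloballyMinimal] (p : ℕ) [Fact p.Prime]
    [NeZero (W.conductorNorm ℤ)] (K : Type) [Field K] [NumberField K],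
    Literature.NumberTheory.EllipticCurves.Rank1Residual.ClassX10 W p →
    ¬ Literature.NumberTheory.EllipticCurves.Rank1Residual.Surj W 3 → ¬ W.HasCM →
    Literature.NumberTheory.EllipticCurves.IsImaginaryQuadratic K → Odd (NumberField.discr K) →
    NumberField.discr K ≠ -3 →
    Literature.NumberTheory.EllipticCurves.SatisfiesHeegnerHypothesis (W.conductorNorm ℤ) K →
    Literature.NumberTheory.EllipticCurves.SatisfiesHeegnerHypothesis p K →
    p ∣ NumberField.classNumber K →
    (W.baseChange K).HasIrreducibleModPGaloisRep p →
    ∀ (ι : K →+* ℚ_[p]) (κ : Literature.NumberTheory.EllipticCurves.ZpExtension K p), κ.IsAnticyclotomic →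
    ∀ (γ : Field.absoluteGaloisGroup K) [Fact (κ.IsTopGenerator γ)]
    (Dt : Literature.NumberTheory.EllipticCurves.ModularForms.ModularParametrizationData W
    (W.conductorNorm ℤ)), ¬ (p : ℤ) ∣ Dt.c →
    ∀ (H : Literature.NumberTheory.EllipticCurves.HeegnerDatum (W.conductorNorm ℤ) (NumberField.discr K))
    (ιC : K →+* ℂ) (P : (W.baseChange K).toAffine.Point),
    WeierstrassCurve.Affine.Point.map ιC.toRatAlgHom P =
    Literature.NumberTheory.EllipticCurves.ModularForms.heegnerPointComplex Dt H →
    (W.baseChange K).mordellWeilRank = 1 →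
    Finite (AddCommGroup.primaryComponent (W.baseChange K).sha p) → ¬ IsOfFinAddOrder P →
    ∃ n : ℕ, Summit.BirchSwinnertonDyer.Rank1Residual.X11b.AcSelmer.XAc.HasCharValuationAt
    (W.baseChange K) p κ (Summit.BirchSwinnertonDyer.Rank1Residual.X11b.inducedPlace ι) ∅ γ n ∧
    (n : ℤ) ≤ 2 * (Summit.BirchSwinnertonDyer.Rank1Residual.X11b.padicLogOrd W p ι P +
    (padicValInt p (1 - W.frobeniusTrace p + p) : ℤ) - 1) := by
  intro W _ _ p _ _ K _ _ hX hns hcm hK hodd h3 hHN hHp hhK hirr ι κ hκ γ _ Dt hc H ιC P hP hrk hfin hPinf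
  have hγ : κ.IsTopGenerator γ := Fact.out
  have hp : p.Prime := Fact.out
  have hp_odd : Odd p := hp.odd_of_ne_two hX.ne_two
  -- an embedding `K̄ → ℂ` over `ιC` for the tied family
  letI : Algebra K ℂ := ιC.toAlgebra
  let jbar : AlgebraicClosure K →+* ℂ :=
    (IsAlgClosed.lift (R := K) (M := ℂ) (S := AlgebraicClosure K)).toRingHom
  -- the data exist (tree theorems)
  obtain ⟨D⟩ := WeierstrassCurve.LambdaAdicSelmerDataExists.nonempty_lambdaAdicSelmerData (W.baseChange K) p κ hγ
  obtain ⟨X⟩ := (W.baseChange K).nonempty_selmerDualData_holds κ γ hγ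
  -- s2c: the coherent pair `(C, F)` on `(Dt, H.β)` AND the μ-inequality at that `C`, printed/tower hypotheses discharged
  obtain ⟨C, F, -, hFDt, -, -, hfwd, ⟨g, hg, hrev⟩, hineq⟩ :=
    h₂c (W.conductorNorm ℤ) W K p κ γ jbar
      (Summit.BirchSwinnertonDyer.BirchSwinnertonDyer.Rank1Residual.X10.thm413Hypotheses_of_classX10
        hX hK h3 hHN hHp hodd hκ hγ)
      hcm hX.irr hirr (hX.hasPadicScalarImage_of_not_surj hns) hHp hhK hX.not_dvd_conductorNorm
      (fun k ↦ hTw K p hp_odd hK κ hκ jbar k) (card_ringClassGalOver_prime_one_of_frame hK hodd h3 hp hHp jbar)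
      Dt H.β H.dvd_sq_sub D X
  -- s2b: CGLS Thm. 4.1.1 / 4.1.3 at `(D, C, X)`
  obtain ⟨hfinS, hfinX, htorC, m, hm⟩ :=
    h₂b W p K hX hns hcm hK hodd h3 hHN hHp hhK hirr κ hκ γ hγ jbar hrk hfin D C X
  -- `𝔖/ℋ_F` torsion, transported along the reverse envelope
  have htorF : Module.IsTorsion (IwasawaAlgebra p) (D.S ⧸ heegnerModule D F) :=
    isTorsion_quotient_heegnerModule_of_smul_stabilizedHeegnerModule_le D F C hg hrev htorC
  haveI := hfinX
  haveI := hfinS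
  haveI : IsNoetherian (IwasawaAlgebra p) X.X := isNoetherian_of_isNoetherianRing_of_finite _ _
  haveI : Module.Finite (IwasawaAlgebra p) (Submodule.torsion (IwasawaAlgebra p) X.X) := inferInstance
  haveI : Module.Finite (IwasawaAlgebra p)
      (D.S ⧸ CastellaGrossiLeeSkinner2022.stabilizedHeegnerModule D C) := inferInstance
  -- promotion IN THE STABILISED CURRENCY at the letter's own `C`: `I(Λκ_∞(C))² ⊆ char_Λ(𝒳_tors)`
  have hleC : CastellaGrossiLeeSkinner2022.stabilizedHeegnerCharIdeal D C ^ 2 ≤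
      Module.charIdeal (IwasawaAlgebra p) (Submodule.torsion (IwasawaAlgebra p) X.X) :=
    IwasawaAlgebra.sq_charIdeal_le_charIdeal_of_span_p_pow_mul_le_of_lengthAt_le_two_mul
      (Submodule.torsion_isTorsion (R := IwasawaAlgebra p) (M := X.X)) htorC (hineq hfinS hfinX htorC) hm
  -- the forward envelope LAST: `I(ℋ_F) ⊆ I(Λκ_C)`, so the TIED containment holds for `F`
  have hle : heegnerCharIdeal D F ^ 2 ≤
      Module.charIdeal (IwasawaAlgebra p) (Submodule.torsion (IwasawaAlgebra p) X.X) :=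
    (Ideal.pow_right_mono (heegnerCharIdeal_le_stabilizedHeegnerCharIdeal_of_le D F C htorF hfwd) 2).trans hleC
  -- s2d: transfer ⇒ U₃
  exact h₂d W p K hX hns hcm hK hodd h3 hHN hHp hirr ι κ hκ γ Dt hc H ιC P hP hrk hfin hPinf
    ⟨jbar, D, F, X, hFDt, hle⟩

/-- **U₃ on ALL odd-`d_K` X10b frames**: merge the two class-number halves. -/
theorem upperLinkAll_of (h₁ : Stmt.upperLinkCoprime)
    (hTw : Stmt.towerSharp) (h₂b : Stmt.localizedStabilizedTorsion) (h₂c : MuPartStabilizedCoherentPair)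
    (h₂d : Stmt.upperLinkOfPinnedContainment) : Stmt.upperLinkAll := by
  intro W _ _ p _ _ K _ _ hX hns hcm hK hodd h3 hHN hHp hirr ι κ hκ γ _ Dt hc H ιC P hP hrk hfin hPinf
  by_cases hh : p ∣ NumberField.classNumber K
  · exact upperLinkDivisible_of hTw h₂b h₂c h₂d W p K hX hns hcm hK hodd h3 hHN hHp hh hirr ι κ hκ γ Dt hc
      H ιC P hP hrk hfin hPinf
  · exact h₁ W p K hX hns hcm hK hodd h3 hHN hHp hh hirr ι κ hκ γ Dt hc H ιC P hP hrk hfin hPinf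

/-- Composition: U₃ on all frames (two class-number halves, the divisible one through its four stages),
then the glue; sorry-free. -/
theorem BeyondCarrierDepthX10b_of (h₁ : Stmt.upperLinkCoprime)
    (hTw : Stmt.towerSharp) (h₂b : Stmt.localizedStabilizedTorsion) (h₂c : MuPartStabilizedCoherentPair)
    (h₂d : Stmt.upperLinkOfPinnedContainment)
    (h₃ : Stmt.upperLinkAll →
      ∀ (W : WeierstrassCurve ℚ) [W.IsElliptic] [W.IsGloballyMinimal] [NeZero (W.conductorNorm ℤ)] (p : ℕ) [Fact p.Prime], Literature.NumberTheory.EllipticCurves.Rank1Residual.ClassX10 W p → ¬ Literature.NumberTheory.EllipticCurves.Rank1Residual.Surj W 3 → ¬ W.HasCM → W.analyticRank = 1 → ∃ B : ℕ, ∀ (K : Type) [Field K] [NumberField K] (Dt : Literature.NumberTheory.EllipticCurves.ModularForms.ModularParametrizationData W (W.conductorNorm ℤ)) (β : ℤ) (ι : K →+* ℂ), Literature.NumberTheory.EllipticCurves.IsImaginaryQuadratic K → B < (NumberField.discr K).natAbs → NumberField.discr K % 8 = 1 → Literature.NumberTheory.EllipticCurves.SatisfiesHeegnerHypothesis (W.conductorNorm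 ℤ) K → Literature.NumberTheory.EllipticCurves.SatisfiesHeegnerHypothesis p K → (4 * (W.conductorNorm ℤ : ℤ)) ∣ β ^ 2 - NumberField.discr K → ¬ (p : ℤ) ∣ Dt.c → ∀ (d₁ : Literature.NumberTheory.EllipticCurves.KolyvaginHeegnerData Dt β ι 1), ¬ IsOfFinAddOrder d₁.derivedPoint → ∀ (s : ℕ), (∀ (q : ℕ) [Fact q.Prime], q ∣ W.conductorNorm ℤ → padicValNat p ((W.baseChange ℚ_[q]).localTamagawaNumber ℤ_[q]) < s) → s ≤ padicValNat p W.tamagawaProduct → ∀ (n : ℕ) (d : Literature.NumberTheory.EllipticCurves.KolyvaginHeegnerData Dt β ι n), Squarefree n → (∀ ℓ ∈ n.primeFactors, Literature.NumberTheory.EllipticCurves.Zhang2014.IsKolyvaginPrime (W.conductorNorm ℤ) W K p ℓ ∧ s ≤ Literature.NumberTheory.EllipticCurves.Zhang2014.kolyvaginIndex W p ℓ) → ∃ Q : (W.baseChange (Literature.NumberTheory.EllipticCurves.ringClassField K ι n)).toAffine.Point, ((p ^ s : ℕ) : ℤ) • Q = d.derivedPoint) :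
    CruxGoal := by
  show BeyondCarrierDepthX10b
  exact h₃ (upperLinkAll_of h₁ hTw h₂b h₂c h₂d)


/-- The same composition with the registered stubs plugged in BY NAME (sorry-tainted until the stubs close). -/
theorem BeyondCarrierDepthX10b_of_stubs : BeyondCarrierDepthX10b :=
  BeyondCarrierDepthX10b_of stub_upperLink_coprimeClassNumber stub_anticyclotomicTowerSharp
    stub_localizedStabilizedTorsion_divisibleClassNumber stub_muPartStabilizedCoherentPair
    stub_upperLink_of_pinnedContainment stub_beyondCarrier_of_upperLink

end Summit.BirchSwinnertonDyer.BirchSwinnertonDyer.Cruxes.BeyondCarrierDepthX10b.HowardFrames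

end
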